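import Summits.QuantumAdvantage.QuantumAdvantage.Theses.StickelbergerGrid

/-!
# Line `birth` — BC3 skeleton for the crux `SectorHardness` (stmt-QuantumAdvantage-17350)

Route `StickelbergerGrid` (route-QuantumAdvantage-StickelbergerGrid; deciding theorem
`closes (hX : SectorHardness) (hG : GaussPowerFBQP) (hP : SectorMembershipOfGrid) : QuantumAdvantage`),
crux rank 4, HYPOTHESIS-TYPE (the route's `X`, "never staffed for proof"; re-audit bin HONEST):

  `SectorHardness := ∃ C : ℕ, L_C ∉ BPP`,

`L_C` = the SECTOR LANGUAGE: Boolean codes (nested `boolPair` of binary numerals) of the tuples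
`(p, ℓ, r, k)` with `p, ℓ` prime, `ℓ` odd, `ℓ ∣ p − 1`, `ℓ ≤ (log₂ p)^C`, `r < p` of exact order `ℓ`
(`r^ℓ ≡ 1 ≢ r`), `k < ℓ`, and `⌊ℓ · (arg S(p,ℓ,r) + π) / 2π⌋ = k`, where
`S(p,ℓ,r) = Σ_{1 ≤ x ≤ p−1} Σ_{j<ℓ} [r^j ≡ x^{(p−1)/ℓ} (mod p)] · e(j/ℓ + x/p)` is the Gauss sum `g(χ_r)` of
the order-`ℓ` character pinned by `r` (route file, item stmt-QuantumAdvantage-17350; every registered stub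
below repeats the route's terms VERBATIM, so the stubs are self-contained over Mathlib + Literature).

THE LINE — "THE GROWING-ORDER BET CONTAINS KUMMER'S BET".  The `ℓ = 3` slice of `L_C` at label `k = 1`
IS Kummer's class I.  For a prime `p ≡ 1 (3)` and `r` a primitive cube root of unity mod `p`,
`G_p := Σ_{x<p} cos(2πx³/p) = g(χ_r) + g(χ̄_r) = 2·Re S(p,3,r)` (cubic residue counting
`#{x : x³ = y} = 1 + χ(y) + χ̄(y)`, `g(χ̄) = conj g(χ)` because `χ(−1) = 1`) and `|S| = √p`, so
`G_p > √p ⟺ |arg S| < π/3 ⟺ ⌊3(arg S + π)/2π⌋ = 1` — the half-open boundary `arg S = −π/3` is excluded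
because `S³ = p·J(χ,χ) ∉ ℝ` (IrelandRosen1990 §8.3 Thm 1 / §9.4; `√p ∉ ℤ[ω]`).  Hence a `BPP` decider for
any ONE `L_C` with `C ≥ 2` (so that `3 ≤ (log₂ p)^C` for every `p ≥ 7`) decides Kummer's class-I language
`KS = {p ≡ 1 (3) prime : G_p > √p}` in `BPP`: on input `p`, sample `a`, put `r := a^{(p−1)/3} mod p`
(a primitive cube root of unity for `2/3` of the units `a`) and query the code of `(p, 3, r, 1)`.  Invalid
`p` and unlucky `r ∈ {0, 1}` are rejected BY `L_C` ITSELF (its validity clauses `p.Prime`, `3 ∣ p − 1`,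
`r^3 % p = 1`, `r % p ≠ 1`), so the reduction is EXACT on NO-instances for every seed, succeeds on
YES-instances for `≥ 1/3` of the seeds, and needs no primality test of its own — precisely the shape of the
LANDED closure theorem `Summit.QuantumAdvantage.QuantumAdvantage.Theorems.IqThreeNotBPP.mem_BPP_of_rurReduction`
("`BPP` is closed downwards under one-sided randomized polynomial-time many-one reductions with success
`≥ 1/q(n)`", Theorems/ArithStatLadderIqThreeNotBPPRURClosure.lean).  Therefore
`KsThesis (KS ∉ BPP) ⟹ SectorHardness`: the crux is the WEAKER hypothesis of the hub's Gauss-sum family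
(recorded on the item: retriage note 2026-08-17T02:11 "implied by KummerSector.KsThesis via the ℓ = 3
slice"; refuter crux-attack 2026-08-17T05:15 "Nearest facts: KsThesis (stmt-1613) ⇒ SectorHardness via
ℓ=3 slice").  The skeleton types exactly this implication, in three registered stubs:

* `stub_kummerHard` (LOAD-BEARING; hypothesis-type; signature = route KummerSector's target `KsThesis`,
  item stmt-QuantumAdvantage-1613, VERBATIM): `KS ∉ BPP` — Kummer 1846 / van Dam–Seroussi 2002 §8 open
  question at FIXED order 3, input `p` alone (no character datum, hence no DLOG/factoring side door).
  Its negation is KummerSector's staffed kill `KsClassical` (stmt-QuantumAdvantage-1616).  It is NOT a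
  restatement of the crux: growing-order hardness does not give order-3 hardness (the converse of this
  line is open), and `stub_kummerHard → SectorHardness` needs stubs 2–3.
* `stub_cubicDictionary` (PROVABLE NOW; size M; Mathlib number theory — `ZMod p` cyclicity,
  `gaussSum`, `jacobiSum`, `Complex.arg`): for `C ≥ 2` and valid `(p, r)`:
  `p ∈ KS ⟺ (p, (3, (r, 1))) ∈ sectorSet C` (the two set-builder terms verbatim), i.e. the arithmetic
  identity above plus the bookkeeping `Nat.Prime 3`, `Odd 3`, `3 ∣ p − 1`, `3 ≤ Nat.log 2 p ^ C`, `1 < 3`.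
* `stub_cubicSliceTransfer` (PROVABLE NOW; size M–L; complexity plumbing ONLY — the dictionary enters as
  a hypothesis, verbatim the statement of stub 2): dictionary → `∀ C ≥ 2, L_C ∈ BPP → KS ∈ BPP`, by
  `mem_BPP_of_rurReduction` with the `FP` sampler `⟨bin p, seed⟩ ↦ code(p, (3, ((seed mod p)^{(p−1)/3} mod p, 1)))`,
  seed length `n + 2`, `q = 3`, `n₀ = 0`, non-numerals mapped to a fixed non-member of `L_C` (e.g. `[]`).
* Composition (sorry-free, pure logic): `sectorHardness_of_stubs` = `C := 2` + modus tollens, concluding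
  the UNFOLDED crux (head `Exists`), so that `SectorHardness_of : SectorHardness` is the ONLY theorem whose
  head is the crux decl (BY NAME, `#h21_check_skeleton` shape).

What the hub gains: the open content of the crux is identified with an EXISTING hypothesis item
(stmt-1613) instead of a second independent bet, and stubs 2–3 are real closable work whose landing
proves `L_2 ∈ BPP → KS ∈ BPP`; in particular a refutation of `SectorHardness` (a `BPP` algorithm for every
`L_C`) would at once prove `KsClassical` and close route KummerSector `refuted:KsThesis` — negative
knowledge propagates across the two routes.

Disproof used: none exists for this crux (`ledger crux ls stmt-QuantumAdvantage-17350`: no workfiles — no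
`Disproof.lean`, no `Theorems/SectorHardness/Negative/*`, 2026-08-17); `ledger negatives --problem
QuantumAdvantage` (6 entries: RegulatorThird.ThirdNotBPP, ShorLocallyDark, CubicStability,
SpinorFlattening.GaussRankPolyThesis, KummerSector.KsNotFrobenian, SeparableFrames) contains no statement
about Gauss-sum sectors, `KS ∉ BPP`, or `BPP` closure; KsNotFrobenian (stmt-1615, a misstated
Frobenian-set claim, dropped) is unrelated to all three stubs.  The refuter's degenerate-witness artefact
(`SectorHardnessDegenerate.lean`: `L_0 = ∅ ∈ BPP`, family monotone in `C`) is honoured: the composition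
uses `C = 2`, never `C = 0`.

`sorry` occurs ONLY in the three `stub_*` theorems.
-/

-- `Summit.<Summit>.<Problem>`: for the single-conjunct summit the duplicate `QuantumAdvantage.QuantumAdvantage` is mandated.
set_option linter.dupNamespace false
set_option linter.unusedVariables false

noncomputable section

namespace Summit.QuantumAdvantage.QuantumAdvantage.Cruxes.SectorHardness.Birth

open Summit.QuantumAdvantage.QuantumAdvantage.Theses.StickelbergerGrid

/-! ## Names for the route's objects
(used by the sanity lemmas and the docstrings; the registered stub signatures are fully unfolded) -/

/-- `S(p, ℓ, r)` — the route's Gauss sum of the order-`ℓ` character pinned by `r`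
(verbatim sub-term of `SectorHardness`). [cite: vanDamSeroussi2002, §4] -/
def gaussSumR (p ℓ r : ℕ) : ℂ :=
  ∑ x ∈ Finset.Icc 1 (p - 1), ∑ j ∈ Finset.range ℓ,
    if r ^ j % p = x ^ ((p - 1) / ℓ) % p then
      Complex.exp (2 * Real.pi * Complex.I * ((j : ℂ) / (ℓ : ℂ) + (x : ℂ) / (p : ℂ))) else 0

/-- The sector label `⌊ℓ · (arg S + π) / 2π⌋` of `S(p, ℓ, r)` (verbatim sub-term of `SectorHardness`).
[cite: vanDamSeroussi2002, §4] -/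
def sectorLabel (p ℓ r : ℕ) : ℤ :=
  Int.floor ((ℓ : ℝ) * (Complex.arg (gaussSumR p ℓ r) + Real.pi) / (2 * Real.pi))

/-- The sector set at exponent `C`: the tuples `(p, (ℓ, (r, k)))` of `L_C`
(verbatim the set-builder term of `SectorHardness`). [folklore] -/
def sectorSet (C : ℕ) : Set (ℕ × (ℕ × (ℕ × ℕ))) :=
  {t : ℕ × (ℕ × (ℕ × ℕ)) | ∃ p ℓ r k : ℕ, t = (p, (ℓ, (r, k))) ∧ p.Prime ∧ ℓ.Prime ∧ Odd ℓ ∧ ℓ ∣ p - 1 ∧ ℓ ≤ Nat.log 2 p ^ C ∧ r < p ∧ r ^ ℓ % p = 1 ∧ r % p ≠ 1 ∧ k < ℓ ∧ Int.floor ((ℓ : ℝ) * (Complex.arg (∑ x ∈ Finset.Icc 1 (p - 1), ∑ j ∈ Finset.range ℓ, if r ^ j % p = x ^ ((p - 1) / ℓ) % p then Complex.exp (2 * Real.pi * Complex.I * ((j : ℂ) / (ℓ : ℂ) + (x : ℂ) / (p : ℂ))) else 0) + Real.pi) / (2 * Real.pi)) = (k : ℤ)}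

/-- The route's Boolean encoding of `ℕ × (ℕ × (ℕ × ℕ))`: nested `boolPair` of binary numerals.
[cite: AroraBarak2009, §0.1] -/
def sectorEncoding : Computability.Encoding (ℕ × (ℕ × (ℕ × ℕ))) Bool :=
  Computability.encodingNatBool.pairBool (Computability.encodingNatBool.pairBool
    (Computability.encodingNatBool.pairBool Computability.encodingNatBool))

/-- The sector language `L_C ⊆ {0,1}*`. [folklore] -/
def sectorLanguage (C : ℕ) : Language Bool :=
  sectorEncoding.toLanguage (sectorSet C)

/-- Kummer's class I, `KS = {p ≡ 1 (3) prime : G_p = Σ_{x<p} cos(2πx³/p) > √p}`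
(verbatim the set of route KummerSector's `KsThesis`, item stmt-QuantumAdvantage-1613).
[cite: IrelandRosen1990, §9.12] -/
def kummerClassI : Set ℕ :=
  {p : ℕ | p.Prime ∧ p % 3 = 1 ∧ Real.sqrt (p : ℝ) < ∑ x ∈ Finset.range p, Real.cos (2 * Real.pi * (x : ℝ) ^ 3 / (p : ℝ))}

/-- Kummer's class-I language over `{0,1}` (input `p` alone, in binary). [folklore] -/
def kummerLanguage : Language Bool :=
  Computability.encodingNatBool.toLanguage kummerClassI

/-- The crux BY NAME is `∃ C, L_C ∉ BPP` over these names (definitional unfolding). [folklore] -/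
theorem sectorHardness_iff :
    SectorHardness ↔ ∃ C : ℕ, sectorLanguage C ∉ Literature.Computability.Complexity.BPP :=
  Iff.rfl

/-- Membership of a tuple in the sector set is the conjunction of the route's clauses (the existential
repackaging is injective). [folklore] -/
theorem mem_sectorSet_iff (C p ℓ r k : ℕ) :
    (p, (ℓ, (r, k))) ∈ sectorSet C ↔
      p.Prime ∧ ℓ.Prime ∧ Odd ℓ ∧ ℓ ∣ p - 1 ∧ ℓ ≤ Nat.log 2 p ^ C ∧ r < p ∧ r ^ ℓ % p = 1 ∧
        r % p ≠ 1 ∧ k < ℓ ∧ sectorLabel p ℓ r = (k : ℤ) := by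
  constructor
  · rintro ⟨p', ℓ', r', k', h, hrest⟩
    obtain ⟨rfl, rfl, rfl, rfl⟩ : p = p' ∧ ℓ = ℓ' ∧ r = r' ∧ k = k' := by
      simpa [Prod.mk.injEq] using h
    exact hrest
  · intro h
    exact ⟨p, ℓ, r, k, rfl, h⟩

/-! ## The three registered stubs (signatures fully unfolded; registered verbatim) -/

/-- **Stub 1 — Kummer hardness** (`KS ∉ BPP`; LOAD-BEARING, hypothesis-type).  VERBATIM the signature of
route KummerSector's target `KsThesis` (item stmt-QuantumAdvantage-1613): the language of primes
`p ≡ 1 (3)` whose cubic exponential sum `G_p = Σ_{x<p} cos(2πx³/p)` exceeds `√p` (Kummer's class I;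
equivalently `g(χ)` is the cube root of `p·J(χ,χ)` of least argument) is not in the tree's `BPP`
(Arora–Barak random-string form).  Why plausibly true: since Kummer 1846 no per-prime method polynomial in
`log p` is known (Cassels–Matthews' elliptic product has `(p−1)/3` factors; Heath-Brown–Patterson /
Patterson give only equidistribution); van Dam–Seroussi 2002 §8 pose classical hardness of Gauss-sum
estimation as open "even under the assumption that factoring and discrete logarithms are easy", and the
input `p` alone carries no side door.  Why it might fail: a Chowla–Mordell/Matthews unit–class-number
formula or a cubic reciprocity descent computing Kummer's trit in P/subexp (KummerSector's staffed kill
`KsClassical`, stmt-QuantumAdvantage-1616).  Size: — (forces `P ≠ PSPACE`; refute-only, like the crux).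
Relation to the crux: STRONGER (this line is `KsThesis ⟹ SectorHardness`; the converse is open).
Sources: vanDamSeroussi2002 §8 p.12 (arXiv:quant-ph/0207131); IrelandRosen1990 §9.12; Matthews1979;
HeathBrownPatterson1979; Literature.Barriers.QuantumAdvantage.SeparationPrerequisites. -/
theorem stub_kummerHard :
    Computability.encodingNatBool.toLanguage {p : ℕ | p.Prime ∧ p % 3 = 1 ∧ Real.sqrt (p : ℝ) < ∑ x ∈ Finset.range p, Real.cos (2 * Real.pi * (x : ℝ) ^ 3 / (p : ℝ))} ∉ Literature.Computability.Complexity.BPP := by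
  sorry

/-- **Stub 2 — the cubic dictionary** (PROVABLE NOW, size M).  For `C ≥ 2`, a prime `p ≡ 1 (3)` and `r < p`
with `r³ ≡ 1 ≢ r (mod p)`: `p` is in Kummer's class I iff the tuple `(p, (3, (r, 1)))` is in the sector
set `sectorSet C` — both set-builder terms verbatim (KummerSector's `KsThesis` set; the route's `L_C` set).
Content: (i) bookkeeping — `Nat.Prime 3`, `Odd 3`, `3 ∣ p − 1`, `3 ≤ Nat.log 2 p ^ C` (as `p ≥ 7`,
`Nat.log 2 p ≥ 2`, `C ≥ 2`), `r < p`, `1 < 3`; (ii) for `1 ≤ x ≤ p − 1`, `x^{(p−1)/3} mod p ∈ {1, r, r² mod p}`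
with exactly one matching `j < 3`, so the inner sum is `χ_r(x)·e(x/p)` for the order-3 character
`χ_r(x) = ω^j`, and `S := S(p,3,r) = g(χ_r)`; (iii) `Σ_{x<p} e(x³/p) = Σ_y (1 + χ_r(y) + χ̄_r(y)) e(y/p)
= g(χ_r) + g(χ̄_r) = S + conj S` (`χ_r(−1) = 1`), whence `Σ_{x<p} cos(2πx³/p) = 2 Re S`, and `|S|² = p`
(`gaussSum_mul_gaussSum_eq_card` + conjugation); (iv) `⌊3(arg S + π)/(2π)⌋ = 1 ⟺ −π/3 ≤ arg S < π/3` and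
`√p < 2√p·cos(arg S) ⟺ |arg S| < π/3`; (v) the boundary `arg S = −π/3` would make `S³ = −p^{3/2}` real,
contradicting `S³ = p·J(χ_r,χ_r)` with `J ∈ ℤ[ω]`, `|J|² = p`, `J ∉ ℝ` (`√p ∉ ℚ(ω)`).
Why it might fail: only by a slip in the half-open conventions (`Complex.arg ∈ (−π, π]`, `Int.floor`) —
checked: label `1` ⟺ `arg S ∈ [−π/3, π/3)`.  Leans on: Mathlib `gaussSum`, `gaussSum_mul_gaussSum_eq_card`,
`jacobiSum`, `ZMod.isCyclic_units` / `IsCyclic.exists_generator`, `Complex.arg_le_pi`,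
`Complex.abs_exp`, `Int.floor_eq_iff`, `Nat.le_log_of_pow_le`.  Sources: IrelandRosen1990 §8.3 Thm 1,
§9.4 Lemma 1 + Cor., §9.12; vanDamSeroussi2002 §4; Mathlib.NumberTheory.GaussSum, Mathlib.NumberTheory.JacobiSum.Basic. -/
theorem stub_cubicDictionary :
    ∀ C p r : ℕ, 2 ≤ C → p.Prime → p % 3 = 1 → r < p → r ^ 3 % p = 1 → r % p ≠ 1 →
      (p ∈ {p : ℕ | p.Prime ∧ p % 3 = 1 ∧ Real.sqrt (p : ℝ) < ∑ x ∈ Finset.range p, Real.cos (2 * Real.pi * (x : ℝ) ^ 3 / (p : ℝ))} ↔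
        (p, (3, (r, 1))) ∈ {t : ℕ × (ℕ × (ℕ × ℕ)) | ∃ p ℓ r k : ℕ, t = (p, (ℓ, (r, k))) ∧ p.Prime ∧ ℓ.Prime ∧ Odd ℓ ∧ ℓ ∣ p - 1 ∧ ℓ ≤ Nat.log 2 p ^ C ∧ r < p ∧ r ^ ℓ % p = 1 ∧ r % p ≠ 1 ∧ k < ℓ ∧ Int.floor ((ℓ : ℝ) * (Complex.arg (∑ x ∈ Finset.Icc 1 (p - 1), ∑ j ∈ Finset.range ℓ, if r ^ j % p = x ^ ((p - 1) / ℓ) % p then Complex.exp (2 * Real.pi * Complex.I * ((j : ℂ) / (ℓ : ℂ) + (x : ℂ) / (p : ℂ))) else 0) + Real.pi) / (2 * Real.pi)) = (k : ℤ)}) := by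
  sorry

/-- **Stub 3 — the cubic slice transfer** (PROVABLE NOW, size M–L; complexity plumbing only).  Given the
dictionary (hypothesis = the statement of `stub_cubicDictionary`, verbatim), for every `C ≥ 2`: if the
sector language `L_C` is in `BPP` then Kummer's class-I language is in `BPP`.  Proof plan: apply the landed
`Summit.QuantumAdvantage.QuantumAdvantage.Theorems.IqThreeNotBPP.mem_BPP_of_rurReduction` (one-sided
randomized many-one reductions, success `≥ 1/q(n)`, `L₂ := L_C`, `L₁ := KS`) with `n₀ := 0`, `q := 3`,
seed length `ℓ(n) := n + 2`, and the `FP` map `f ⟨x, seed⟩ :=` if `x = bin p` for a numeral `p` then the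
route's code of `(p, (3, ((seed-as-number mod p)^{(p−1)/3} mod p, 1)))` else `[]` (a fixed non-member:
every code word of the nested `boolPair` encoding is non-empty).  NO side, every seed: if `p` is not a
prime `≡ 1 (3)` the tuple violates `p.Prime ∧ 3 ∣ p − 1`; if `r := a^{(p−1)/3} mod p ∈ {0, 1}` it violates
`r ^ 3 % p = 1 ∧ r % p ≠ 1`; otherwise `r` is a primitive cube root of unity and the dictionary gives
`(p,(3,(r,1))) ∈ sectorSet C ⟺ p ∈ KS`, false — so NO test of primality is needed inside `f`.  YES side
(`p ∈ KS`, so `p ≥ 7`): the tuple is in `L_C` iff `a := seed mod p` is a non-cube unit, i.e. for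
`2(p−1)/3` residues; with `2^{n+2} ≥ 4p` seeds the good fraction is `≥ (2(p−1)/3p)(1 − p/2^{n+2}) ≥ 3/7 ≥ 1/3`.
`f ∈ FP`: `decodeNat`, `mod`, modular exponentiation (exponent `< p`, square-and-multiply), the `boolPair`
encoders — the tree's `FP` bricks (`Brick.*`, `comp_mem_FP`; cf. the landed sampler
`Theorems.IqThreeNotBPP.stub_samplerCubeFP` for the idiom).  Why it might fail: not mathematically; AS
TYPED only through `FP`-plumbing cost (the modular-exponentiation brick may have to be written).
Leans on: `mem_BPP_of_rurReduction`, `Literature.Computability.Complexity.preimage_mem_BPP`,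
`mem_BPP_of_eqOn_le`, `Computability.Encoding.mem_toLanguage_iff`, `FP`, `boolPair`.
Sources: AroraBarak2009 §7.6 (Def. 7.16 + remark), Micciancio2001 §2 (RUR reductions), Ko1982. -/
theorem stub_cubicSliceTransfer :
    (∀ C p r : ℕ, 2 ≤ C → p.Prime → p % 3 = 1 → r < p → r ^ 3 % p = 1 → r % p ≠ 1 →
      (p ∈ {p : ℕ | p.Prime ∧ p % 3 = 1 ∧ Real.sqrt (p : ℝ) < ∑ x ∈ Finset.range p, Real.cos (2 * Real.pi * (x : ℝ) ^ 3 / (p : ℝ))} ↔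
        (p, (3, (r, 1))) ∈ {t : ℕ × (ℕ × (ℕ × ℕ)) | ∃ p ℓ r k : ℕ, t = (p, (ℓ, (r, k))) ∧ p.Prime ∧ ℓ.Prime ∧ Odd ℓ ∧ ℓ ∣ p - 1 ∧ ℓ ≤ Nat.log 2 p ^ C ∧ r < p ∧ r ^ ℓ % p = 1 ∧ r % p ≠ 1 ∧ k < ℓ ∧ Int.floor ((ℓ : ℝ) * (Complex.arg (∑ x ∈ Finset.Icc 1 (p - 1), ∑ j ∈ Finset.range ℓ, if r ^ j % p = x ^ ((p - 1) / ℓ) % p then Complex.exp (2 * Real.pi * Complex.I * ((j : ℂ) / (ℓ : ℂ) + (x : ℂ) / (p : ℂ))) else 0) + Real.pi) / (2 * Real.pi)) = (k : ℤ)})) →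
    ∀ C : ℕ, 2 ≤ C →
      (Computability.encodingNatBool.pairBool (Computability.encodingNatBool.pairBool (Computability.encodingNatBool.pairBool Computability.encodingNatBool))).toLanguage {t : ℕ × (ℕ × (ℕ × ℕ)) | ∃ p ℓ r k : ℕ, t = (p, (ℓ, (r, k))) ∧ p.Prime ∧ ℓ.Prime ∧ Odd ℓ ∧ ℓ ∣ p - 1 ∧ ℓ ≤ Nat.log 2 p ^ C ∧ r < p ∧ r ^ ℓ % p = 1 ∧ r % p ≠ 1 ∧ k < ℓ ∧ Int.floor ((ℓ : ℝ) * (Complex.arg (∑ x ∈ Finset.Icc 1 (p - 1), ∑ j ∈ Finset.range ℓ, if r ^ j % p = x ^ ((p - 1) / ℓ) % p then Complex.exp (2 * Real.pi * Complex.I * ((j : ℂ) / (ℓ : ℂ) + (x : ℂ) / (p : ℂ))) else 0) + Real.pi) / (2 * Real.pi)) = (k : ℤ)} ∈ Literature.Computability.Complexity.BPP →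
      Computability.encodingNatBool.toLanguage {p : ℕ | p.Prime ∧ p % 3 = 1 ∧ Real.sqrt (p : ℝ) < ∑ x ∈ Finset.range p, Real.cos (2 * Real.pi * (x : ℝ) ^ 3 / (p : ℝ))} ∈ Literature.Computability.Complexity.BPP := by
  sorry

/-! ## Sanity lemmas (sorry-free): the stubs say what the docstrings say -/

/-- Stub 1 is, by `Iff.rfl`, `kummerLanguage ∉ BPP` (and verbatim KummerSector's `KsThesis`). [folklore] -/
theorem stub_kummerHard_iff :
    (Computability.encodingNatBool.toLanguage {p : ℕ | p.Prime ∧ p % 3 = 1 ∧ Real.sqrt (p : ℝ) < ∑ x ∈ Finset.range p, Real.cos (2 * Real.pi * (x : ℝ) ^ 3 / (p : ℝ))} ∉ Literature.Computability.Complexity.BPP) ↔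
      kummerLanguage ∉ Literature.Computability.Complexity.BPP :=
  Iff.rfl

/-- Stub 2's two set-builder terms are `kummerClassI` and `sectorSet C` (definitional). [folklore] -/
theorem stub_cubicDictionary_iff :
    (∀ C p r : ℕ, 2 ≤ C → p.Prime → p % 3 = 1 → r < p → r ^ 3 % p = 1 → r % p ≠ 1 →
      (p ∈ {p : ℕ | p.Prime ∧ p % 3 = 1 ∧ Real.sqrt (p : ℝ) < ∑ x ∈ Finset.range p, Real.cos (2 * Real.pi * (x : ℝ) ^ 3 / (p : ℝ))} ↔
        (p, (3, (r, 1))) ∈ {t : ℕ × (ℕ × (ℕ × ℕ)) | ∃ p ℓ r k : ℕ, t = (p, (ℓ, (r, k))) ∧ p.Prime ∧ ℓ.Prime ∧ Odd ℓ ∧ ℓ ∣ p - 1 ∧ ℓ ≤ Nat.log 2 p ^ C ∧ r < p ∧ r ^ ℓ % p = 1 ∧ r % p ≠ 1 ∧ k < ℓ ∧ Int.floor ((ℓ : ℝ) * (Complex.arg (∑ x ∈ Finset.Icc 1 (p - 1), ∑ j ∈ Finset.range ℓ, if r ^ j % p = x ^ ((p - 1) / ℓ) % p then Complex.exp (2 *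 Real.pi * Complex.I * ((j : ℂ) / (ℓ : ℂ) + (x : ℂ) / (p : ℂ))) else 0) + Real.pi) / (2 * Real.pi)) = (k : ℤ)})) ↔
      ∀ C p r : ℕ, 2 ≤ C → p.Prime → p % 3 = 1 → r < p → r ^ 3 % p = 1 → r % p ≠ 1 →
        (p ∈ kummerClassI ↔ (p, (3, (r, 1))) ∈ sectorSet C) :=
  Iff.rfl

/-- The slice language of stub 3 is `sectorLanguage C` and its target `kummerLanguage` (definitional).
[folklore] -/
theorem sectorLanguage_eq (C : ℕ) :
    sectorLanguage C =
      (Computability.encodingNatBool.pairBool (Computability.encodingNatBool.pairBool (Computability.encodingNatBool.pairBool Computability.encodingNatBool))).toLanguage {t : ℕ × (ℕ × (ℕ × ℕ)) | ∃ p ℓ r k : ℕ, t = (p, (ℓ, (r, k))) ∧ p.Prime ∧ ℓ.Prime ∧ Odd ℓ ∧ ℓ ∣ p - 1 ∧ ℓ ≤ Nat.log 2 p ^ C ∧ r < p ∧ r ^ ℓ % p = 1 ∧ r % p ≠ 1 ∧ k < ℓ ∧ Int.floor ((ℓ : ℝ) * (Complex.arg (∑ x ∈ Finset.Icc 1 (p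 - 1), ∑ j ∈ Finset.range ℓ, if r ^ j % p = x ^ ((p - 1) / ℓ) % p then Complex.exp (2 * Real.pi * Complex.I * ((j : ℂ) / (ℓ : ℂ) + (x : ℂ) / (p : ℂ))) else 0) + Real.pi) / (2 * Real.pi)) = (k : ℤ)} :=
  rfl

/-! ## The composition: stub signatures ⟹ the crux (sorry-free, pure logic) -/

/-- **The real composition** (`C := 2`, modus tollens).  From the three stub statements taken as
hypotheses verbatim: if `L_2` were in `BPP`, the slice transfer (stub 3) fed with the dictionary (stub 2)
would put Kummer's class-I language in `BPP`, contradicting stub 1; hence `L_2 ∉ BPP`, a witness for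
`∃ C, L_C ∉ BPP`.  The conclusion is deliberately the UNFOLDED crux so that `SectorHardness_of` below is
the only theorem whose head is the crux decl. [folklore] -/
theorem sectorHardness_of_stubs
    (hKS : Computability.encodingNatBool.toLanguage {p : ℕ | p.Prime ∧ p % 3 = 1 ∧ Real.sqrt (p : ℝ) < ∑ x ∈ Finset.range p, Real.cos (2 * Real.pi * (x : ℝ) ^ 3 / (p : ℝ))} ∉ Literature.Computability.Complexity.BPP)
    (hdict : ∀ C p r : ℕ, 2 ≤ C → p.Prime → p % 3 = 1 → r < p → r ^ 3 % p = 1 → r % p ≠ 1 →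
      (p ∈ {p : ℕ | p.Prime ∧ p % 3 = 1 ∧ Real.sqrt (p : ℝ) < ∑ x ∈ Finset.range p, Real.cos (2 * Real.pi * (x : ℝ) ^ 3 / (p : ℝ))} ↔
        (p, (3, (r, 1))) ∈ {t : ℕ × (ℕ × (ℕ × ℕ)) | ∃ p ℓ r k : ℕ, t = (p, (ℓ, (r, k))) ∧ p.Prime ∧ ℓ.Prime ∧ Odd ℓ ∧ ℓ ∣ p - 1 ∧ ℓ ≤ Nat.log 2 p ^ C ∧ r < p ∧ r ^ ℓ % p = 1 ∧ r % p ≠ 1 ∧ k < ℓ ∧ Int.floor ((ℓ : ℝ) * (Complex.arg (∑ x ∈ Finset.Icc 1 (p - 1), ∑ j ∈ Finset.range ℓ, if r ^ j % p = x ^ ((p - 1) / ℓ) % p then Complex.exp (2 * Real.pi * Complex.I * ((j : ℂ) / (ℓ : ℂ) + (x : ℂ) / (p : ℂ))) else 0) + Real.pi) / (2 * Real.pi)) = (k : ℤ)}))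
    (htransfer :
      (∀ C p r : ℕ, 2 ≤ C → p.Prime → p % 3 = 1 → r < p → r ^ 3 % p = 1 → r % p ≠ 1 →
        (p ∈ {p : ℕ | p.Prime ∧ p % 3 = 1 ∧ Real.sqrt (p : ℝ) < ∑ x ∈ Finset.range p, Real.cos (2 * Real.pi * (x : ℝ) ^ 3 / (p : ℝ))} ↔
          (p, (3, (r, 1))) ∈ {t : ℕ × (ℕ × (ℕ × ℕ)) | ∃ p ℓ r k : ℕ, t = (p, (ℓ, (r, k))) ∧ p.Prime ∧ ℓ.Prime ∧ Odd ℓ ∧ ℓ ∣ p - 1 ∧ ℓ ≤ Nat.log 2 p ^ C ∧ r < p ∧ r ^ ℓ % p = 1 ∧ r % p ≠ 1 ∧ k < ℓ ∧ Int.floor ((ℓ : ℝ) * (Complex.arg (∑ x ∈ Finset.Icc 1 (p - 1), ∑ j ∈ Finset.range ℓ, if r ^ j % p = x ^ ((p - 1) / ℓ) % p then Complex.exp (2 * Real.pi * Complex.I * ((j : ℂ) / (ℓ : ℂ) + (x : ℂ) / (p : ℂ))) else 0) + Real.pi) / (2 * Real.pi)) = (k : ℤ)})) →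
      ∀ C : ℕ, 2 ≤ C →
        (Computability.encodingNatBool.pairBool (Computability.encodingNatBool.pairBool (Computability.encodingNatBool.pairBool Computability.encodingNatBool))).toLanguage {t : ℕ × (ℕ × (ℕ × ℕ)) | ∃ p ℓ r k : ℕ, t = (p, (ℓ, (r, k))) ∧ p.Prime ∧ ℓ.Prime ∧ Odd ℓ ∧ ℓ ∣ p - 1 ∧ ℓ ≤ Nat.log 2 p ^ C ∧ r < p ∧ r ^ ℓ % p = 1 ∧ r % p ≠ 1 ∧ k < ℓ ∧ Int.floor ((ℓ : ℝ) * (Complex.arg (∑ x ∈ Finset.Icc 1 (p - 1), ∑ j ∈ Finset.range ℓ, if r ^ j % p = x ^ ((p - 1) / ℓ) % p then Complex.exp (2 * Real.pi * Complex.I * ((j : ℂ) / (ℓ : ℂ) + (x : ℂ) / (p : ℂ))) else 0) + Real.pi) / (2 * Real.pi)) = (k : ℤ)} ∈ Literature.Computability.Complexity.BPP →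
        Computability.encodingNatBool.toLanguage {p : ℕ | p.Prime ∧ p % 3 = 1 ∧ Real.sqrt (p : ℝ) < ∑ x ∈ Finset.range p, Real.cos (2 * Real.pi * (x : ℝ) ^ 3 / (p : ℝ))} ∈ Literature.Computability.Complexity.BPP) :
    ∃ C : ℕ, (Computability.encodingNatBool.pairBool (Computability.encodingNatBool.pairBool (Computability.encodingNatBool.pairBool Computability.encodingNatBool))).toLanguage {t : ℕ × (ℕ × (ℕ × ℕ)) | ∃ p ℓ r k : ℕ, t = (p, (ℓ, (r, k))) ∧ p.Prime ∧ ℓ.Prime ∧ Odd ℓ ∧ ℓ ∣ p - 1 ∧ ℓ ≤ Nat.log 2 p ^ C ∧ r < p ∧ r ^ ℓ % p = 1 ∧ r % p ≠ 1 ∧ k < ℓ ∧ Int.floor ((ℓ : ℝ) * (Complex.arg (∑ x ∈ Finset.Icc 1 (p - 1), ∑ j ∈ Finset.range ℓ, if r ^ j % p = x ^ ((p - 1) / ℓ) % p then Complex.exp (2 * Real.pi * Complex.I * ((j : ℂ) / (ℓ : ℂ) + (x : ℂ) / (p : ℂ))) else 0) + Real.pi) / (2 * Real.pi)) = (k : ℤ)}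 ∉ Literature.Computability.Complexity.BPP :=
  ⟨2, fun h₂ => hKS (htransfer hdict 2 le_rfl h₂)⟩

/-- **THE skeleton theorem** — the crux `SectorHardness` BY NAME from the three declared stubs via the
sorry-free composition `sectorHardness_of_stubs` (`ledger skeleton check` shape: no hypotheses; `sorry`
enters only through `stub_kummerHard`, `stub_cubicDictionary`, `stub_cubicSliceTransfer`). [folklore] -/
theorem SectorHardness_of : SectorHardness :=
  sectorHardness_of_stubs stub_kummerHard stub_cubicDictionary stub_cubicSliceTransfer

end Summit.QuantumAdvantage.QuantumAdvantage.Cruxes.SectorHardness.Birth
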